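import Summits.BirchSwinnertonDyer.BirchSwinnertonDyer.Theses.PrintCFram
import Summits.BirchSwinnertonDyer.BirchSwinnertonDyer.Theorems.PrintCFramBottomClassIndexLawFiveLeRegularLocusBSDp
import Summits.BirchSwinnertonDyer.BirchSwinnertonDyer.Theorems.PrintCFramBottomClassIndexLawFiveLeRegularLocusBottomLayer
import Summits.BirchSwinnertonDyer.BirchSwinnertonDyer.Theorems.PrintCFramBottomClassIndexLawFiveLeKrizLiLocusKolyvagin
import Summits.BirchSwinnertonDyer.BirchSwinnertonDyer.Theorems.PrintCFramBottomClassIndexLawFiveLeEisensteinLineDataOfPrint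
import Summits.BirchSwinnertonDyer.BirchSwinnertonDyer.Theorems.PrintCFramBottomClassIndexLawFiveLeEisensteinEndStatePointwise
import Summits.BirchSwinnertonDyer.BirchSwinnertonDyer.Theorems.PrintCFramBottomClassIndexLawFiveLeEisensteinEndStateV7
import Literature.NumberTheory.EllipticCurves.ZpExtensionAnticyclotomicHoldsProofs
import Literature.NumberTheory.EllipticCurves.BSDSelmerParityDokchitserTowerProofs
import Literature.NumberTheory.NumberFields.CongruenceSubgroupTorsionFree
import HarnessLib

/-!
# Crux `PrintCFram.BottomClassIndexLawFiveLe` (item stmt-BirchSwinnertonDyer-20372) — line `herbrand-regular-locus`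
# (ideator seat bsd-idea-7, generation g7, lens «complete» = program-completion: the classical STICKELBERGER–HERBRAND /
# IWASAWA–GILLARD programme on eigenspaces of class groups and of semi-local units modulo cyclotomic units, completed at the
# one place the lead's skeleton of record still pays a research price ON the Kriz–Li locus: the REGULARITY of the frame)

HONEST FRAMING. Nothing is proved about BSD here. FIVE `sorry`'d stubs — two PRINT (`stub_prints`, `stub_krizLi`, VERBATIM the
lead's), ONE NEW research-M stub (`stub_bottomResidualSelmer_trivial_of_bernoulliPair`), two research stubs VERBATIM the lead's but
RESTRICTED OFF the Kriz–Li locus (`stub_flatEisensteinIncl_cmRamified_offKrizLi` = the lead's v7 β1 word for word;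
`stub_kolyvaginUpper_offKrizLi` = the lead's `stub_kolyvaginUpper_borelCM` with the extra hypothesis `¬ ∃ (Kriz–Li datum)`) — and ONE
kernel-checked composition `BottomClassIndexLawFiveLe_of : … BottomClassIndexLawFiveLe` (no `sorry` outside the stubs). Publish-only
(ruling W-79): this seat runs no `skeleton check`; the lead's `Lines/eisenstein_resource_bdp_line.lean` (v7) stays the skeleton of
record. BSD is not proved by any of this.

## The gap this line completes (named by the lead g5 §5.1 and by w2g4's `…RegularLocusBottomLayer` READING paragraph, typed by nobody)

The lead's v7 composition has three cases: (A) a REGULAR Kriz–Li datum ⟹ the crux's conclusion from PRINT alone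
(`RegularLocus.ramifiedCMBottomClassIndexLawAtZp_of_regularKrizLiDatum`, p630429); (B) a Kriz–Li datum WITHOUT regularity ⟹ print +
the Kolyvagin UPPER inequality at a residually REDUCIBLE prime (`stub_kolyvaginUpper_borelCM`, research-M/L: the `p^M`-coefficient port of
Gross §§3–6 with no Kolyvagin-system machinery available); (C) no datum ⟹ β1 + Kolyvagin. Regularity of the frame `(κ, γ, 𝔭)` means
`#R_𝔭^S(K''_∞, Φ) = #R_𝔭^S(K''_∞, W[p]/Φ) = 1` for the isogeny line `Φ`, and w2g4 reduced it (p631615 + `…BottomLayer`) to the BOTTOM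
LAYER: `R_𝔭^S(K'', Φ) = R_𝔭^S(K'', W[p]/Φ) = 0` over `K''` itself (`natCard_residualSelmer_eq_one_of_bottom`, Nakayama over `𝔽_p⟦Γ⟧`).
THIS LINE's thesis: on the Kriz–Li locus the bottom layer vanishes BECAUSE OF Kriz–Li's own hypothesis (4) — the SAME two Bernoulli
numbers `B_{1,ψ₀⁻¹ε_K}`, `B_{1,ψ₀ω⁻¹}` that make `log_{ω_W} P_{K''}` a unit also kill the four class-group eigenspaces and the two
unit indices that bound the two residual Selmer groups. So case (B) COLLAPSES INTO case (A): on the whole Kriz–Li locus the crux is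
PRINT + one M-sized class-field-theory lemma — NO Kolyvagin, NO main conjecture, NO `p`-adic `L`-function of `W`, NO `Λ`.

## Mechanism of the new stub (the dictionary; `K = K''` Heegner for `N_W`, `p = 𝔭𝔭̄` split, `θ ∈ {ψ|_{G_K}, (ψ⁻¹ω)|_{G_K}}` the
## characters of `Φ` and `W[p]/Φ`, `L = K(θ) = K·ℚ(θ₀)`, `Δ = Gal(L/K)`, `G = Gal(L/ℚ) = Δ × ⟨c⟩`, `p ∤ |G|`)

(M1, class field theory, the M-sized content.) `R_𝔭^S(K, 𝔽_p(θ))` (unramified outside `S ∪ {v ∣ p}`, STRICT at `𝔭`, no condition at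
`𝔭̄` and at `S`) injects by inflation–restriction (`p ∤ |Δ|`) into `Hom(Gal(M/L), 𝔽_p)^{(θ)}`, `M` = maximal elementary-abelian
`p`-extension of `L` unramified outside `T = S_L ∪ {w ∣ 𝔭̄}` and split at every `w ∣ 𝔭`; by global class field theory
`0 → (∏_{w∈T} U_w ⊗ ℤ_p)/Ē_L^{(𝔭)} → Gal(M^{full}/L) → Cl_L^{(𝔭)} ⊗ ℤ_p → 0`, whence
`dim_𝔽p R_𝔭^S(K, θ) ≤ dim ((U_𝔭̄(L) ⊗ ℤ_p)^{(θ)}/Ē_L^{(θ)}) ⊗ 𝔽_p + dim (Cl_L ⊗ 𝔽_p)^{(θ)}`: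
the `S`-terms vanish because `U_w ⊗ ℤ_p = μ_{p^∞}(L_w)` has character `ω|_{Δ_w}`, unramified at `w ∤ p`, while `θ` IS ramified at
every `v ∈ S` (additive `ℓ ≠ p`, `p ≥ 7 ∤ |Φ_ℓ|`, `Φ_ℓ ↪ Aut W[p]`, `θ·θ' = ω` unramified at `ℓ`); the `𝔭`-unit correction vanishes
because `ℤ[{w ∣ 𝔭}] = Ind_{Δ_𝔭}^Δ 𝟙` has no `θ`-part (`θ|_{I_𝔭} = ω^a`, `a ∈ {(p+1)/4, (3p−1)/4}`, `a ≢ 0, 1 (mod p−1)`); the torsion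
`μ(L_w)`, `w ∣ 𝔭̄`, has character `ω ≠ θ` on inertia. Under `G ⊃ Δ` the `θ`-isotypic parts split along the two lifts of `θ` to `ℚ`:
`(Cl_L ⊗ ℤ_p)^{(θ)} = A^{(θ₀)} ⊕ A^{(θ₀ε_K)}` (one ODD, one EVEN lift, `c` = complex conjugation), and `(U_𝔭̄(L) ⊗ ℤ_p)^{(θ)} ≅
e_χ U_p(L) = U_p(ℚ(χ))^{(χ)}` for the EVEN lift `χ` (graph of `c`, which swaps `𝔭 ↔ 𝔭̄`), with `Ē_L^{(θ)} ⊇ C̄_{ℚ(χ)}^{(χ)}`.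
(F1, PRINT — Stickelberger–Herbrand.) `F` imaginary abelian, `p ∤ [F:ℚ]`, `χ` odd, `χ ≠ ω`, `p ∤ B_{1,χ⁻¹}` ⟹ `(Cl_F ⊗ ℤ_p)^{(χ)} = 0`.
(F2, PRINT — Leopoldt reflection.) `F` CM abelian, `μ_p ⊂ F`, `p ∤ [F:ℚ]`, `χ` even, `χ ≠ 1` ⟹
`rk_p (Cl_F)^{(χ)} ≤ rk_p (Cl_F)^{(ωχ⁻¹)}` (Kummer theory; the odd unit eigenspace `E_F^{(ωχ⁻¹)} ⊗ 𝔽_p` is `0` for `ωχ⁻¹ ≠ ω`).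
(F3, PRINT — Iwasawa–Gillard, Tsuji 1999 Rem. 3 (i).) `K₀ = F(μ_p)`, `F` abelian unramified at `p`, `p ∤ [K₀:ℚ]`, `χ` even non-trivial
with `(χω⁻¹)~(p) ≠ 1`: `e_χ(U_∞/C_∞) ≅ Λ_χ/(g_χ(T))`, `g_χ(κ(γ₀)^s − 1) = L_p(χ, 1−s)` (Iwasawa, `g_χ ∈ ℤ_p[χ]⟦T⟧`); descending to
level `0` (`χ|_{D_p} ≠ 1` ⟹ universal norms fill `U₀^{(χ)}`; norms of cyclotomic units are cyclotomic units):
`#(U_p(ℚ(χ)) ⊗ ℤ_p)^{(χ)}/C̄^{(χ)} ≤ #ℤ_p[χ]/(L_p(χ,1))`.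
(F4, PRINT — the value formula.) `L_p(χ, 0) = −(1 − χω⁻¹(p)) B_{1,χω⁻¹}` and `g_χ(κ(γ₀)−1) ≡ g_χ(0) (mod p)`, so for `p ∣ f(χω⁻¹)`:
`L_p(χ,1) ∈ ℤ_p[χ]^× ⟺ B_{1,χω⁻¹} ∈ ℤ_p[χ]^×`.
BOOKKEEPING (ψ = χ_d·ω^a ODD on all 65 rank-one classes of the window, w2g4 census): write `b₁ = B_{1,ψ⁻¹}`, `b₂ = B_{1,ψε_Kω⁻¹}` —
for odd `ψ`, `ψ₀ = ψε_K` and Kriz–Li's pair (4) is exactly `b₁·b₂` (`…RegularLocusBernoulliPairOdd`, p634386). For `θ = ψ`: odd lift `ψ`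
← `b₁` (F1); even lift `ψε_K` ← `A^{(ψ⁻¹ε_Kω)}` ← `b₂` (F2, F1); unit index, `χ = ψε_K` ← `L_p(ψε_K,1)` ← `b₂` (F3, F4). For
`θ' = ψ⁻¹ω`: odd lift `ψ⁻¹ωε_K` ← `B_{1,ψω⁻¹ε_K} = b₂` (F1); even lift `ψ⁻¹ω` ← `A^{(ψ)}` ← `b₁` (F2, F1); unit index, `χ = ψ⁻¹ω` ←
`L_p(ψ⁻¹ω,1)` ← `B_{1,ψ⁻¹} = b₁` (F3, F4). Each Bernoulli number is used three times; (4) ⟹ all six terms vanish ⟹ both bottom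
residual Selmer groups are `0` — for EVERY stable line `Φ` of order `p` (its character is `θ` or `θ'`, the quotient's the other; the two
differ on `G_{K''}` because `ψ²ω⁻¹ = ω^{(p−1)/2} = ε_{ℚ(√−p)} ≠ ε_{K''}`, `p` being split in `K''`).

## Nearest PRINT prior art (searched; honest grade: new-combination) and what is NEW relative to it and to the tree
Gross, LNM 776 §22.3 (Lemma 22.3.4, Cor. 22.3.5, Thm. 22.3.6, PDF pp. 80–82): the `√−p`-descent on the UNTWISTED `A(p)` over `K(μ_p)`,
`K = ℚ(√−p)` (where `p` RAMIFIES), is killed by ONE classical Bernoulli number through Herbrand eigenspaces of `Cl(ℚ(μ_p))` (for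
`p ≡ 3 (mod 8)`: `B_{(3p−1)/4} ≢ 0 (mod p) ⟹ S_w(A(p)) = 𝒪/w𝒪`) — the same KIND of move, for the true `w`-Selmer group, `d = 1`, no
unit index. Kriz–Li 2019 p. 3 and §8 go the OTHER way (trivial relative `p`-class numbers ⟹ (4), to produce examples) and never connect
(4) to a Selmer group or to regularity. This line transplants Gross's Herbrand descent to (twists `d`, a Heegner field `K''` with `p`
SPLIT, the BDP-type residual Selmer groups at layer `0`, Kriz–Li's PAIR) and adds the unit-index half; relative to the tree
(lead g5 §5.1 «Herbrand direction», w2g4 READING «one Gras-type theorem away», CGLS Prop. 14):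
(i) the UNIT-INDEX half (F3/F4): the `𝔭̄`-relaxed condition costs exactly `[U^{(χ_even)} : C̄^{(χ_even)}] = #ℤ_p/L_p(χ_even, 1)`, and
`L_p(χ_even,1)` is a unit iff the SECOND use of the same Bernoulli number is — so no Gras conjecture / Mazur–Wiles / Rubin main
conjecture is needed (the tree's CGLS Prop. 14 fact `prop14_residualCharacterSelmer_finite` gives finiteness over `K''_∞` only, via
Rubin's IMC; this line needs `= 0` at the bottom layer and gets it from FINITE-LEVEL print); (ii) the exact four-eigenspace ↔
two-Bernoulli pairing above, which shows hypothesis (4) is not merely sufficient for `log P` but is the regularity of the frame;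
(iii) the collapse (B) ⊂ (A): the Kolyvagin stub is needed only OFF the locus (17424bl1 @ 11, 305809c1 @ 7 — the two level-one cells
where `p ∣ b₁` — and any `W` with no admissible `K''`; w2g4 census: (4) holds for 409/520 (class, `d_K`) pairs, for 63/65 classes).

## Dead lines avoided / Disproof used
No `p`-adic `L`-function of `W`, no `Λ`-adic object, no functional equation: the catalogued barriers `CMRankOneAtRamifiedPrime`
(no cyclotomic/anticyclotomic main conjecture at the additive supersingular ramified prime) and `ReducibleAnticyclotomicAtBadP` are not met —
the only Iwasawa theory used is Iwasawa's theorem on cyclotomic units of ABELIAN fields over `ℚ` (F3), at a prime where those fields are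
tamely ramified. Not `katz-genus-crossing` (no Katz two-variable measure), not `relative-anchor-transfer` (no transfer across twists: the
statement is per `(W, K'')`), not the dead «CGLS Prop. 14 ⟹ card 1» reading (finiteness ≠ triviality; this line never uses Prop. 14).
Disproof.lean for this crux: none published (`ledger crux ls`: no `Disproof.lean`); nothing to honour beyond the negatives index (no
entry touches residual Selmer groups of characters).

[cite: KrizLi2019, Thm. 1.20 (pp. 7–8), Rem. 1.21 (p. 8) and p. 3 (doi:10.1017/fms.2019.9)]
[cite: Tsuji1999, Thm. 3.1, Rem. 3 (i) p. 9 («the theorem of Iwasawa and Gillard») and Thm. 4.3 (J. Number Theory 78, doi:10.1006/jnth.1999.2398)]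
[cite: Gillard1979b, Thm. 1–2 (Ann. Inst. Fourier 29 (4), doi:10.5802/aif.763)] [cite: Iwasawa1964, §§2–3 (J. Math. Soc. Japan 16)]
[cite: Lang1990CyclotomicFields, Ch. 1 §2 Thm. 2.4, §3 Thm. 3.1 and Cor. 3 (pp. 25–28); Ch. 4 (p-adic L-function values); Ch. 7 §5 Thms. 5.1–5.2 (pp. 132–133)]
[cite: Washington1997, Thms. 5.11, 6.10, 6.17, 10.9 and Prop. 13.26] [cite: Sinnott1980, Thms. 4.1 and 5.1 (Invent. Math. 62)]
[cite: Gross1980LNM776, §22.3 Lemma 22.3.4, Cor. 22.3.5, Thm. 22.3.6 (PDF pp. 80–82) — nearest prior art] [cite: GreenbergLNM1716, §3 Lemmas 3.1–3.2 (PDF p. 86)] [cite: CastellaGrossiLeeSkinner2022, §1.2 Prop. 14 (arXiv:2008.02571) — NOT used; contrast]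
-/

noncomputable section

open scoped Classical

set_option linter.dupNamespace false
set_option autoImplicit false

namespace Summit.BirchSwinnertonDyer.BirchSwinnertonDyer.Cruxes.BottomClassIndexLawFiveLe.HerbrandRegularLocus

open WeierstrassCurve NumberField IsDedekindDomain Field PowerSeries
  Literature.NumberTheory.EllipticCurves
  Literature.NumberTheory.EllipticCurves.ModularForms
  Literature.NumberTheory.EllipticCurves.Rank1Residual
  Literature.NumberTheory.EllipticCurves.Rank1Residual.Typed
  Literature.NumberTheory.EllipticCurves.KrizLi2019
  Literature.NumberTheory.GaloisRepresentations
  Literature.NumberTheory.GaloisCohomology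
  Literature.NumberTheory.NumberFields
  Summit.BirchSwinnertonDyer.Rank1Residual
  Summit.BirchSwinnertonDyer.Rank1Residual.Additive
  Summit.BirchSwinnertonDyer.Rank1Residual.X11b
  Summit.BirchSwinnertonDyer.Rank1Residual.X11b.AcSelmer
  Summit.BirchSwinnertonDyer.Rank1Residual.X11b.Halves
  Summit.BirchSwinnertonDyer.Rank1Residual.X11b.CongruenceLimit
  Summit.BirchSwinnertonDyer.Rank1Residual.X12
  Summit.BirchSwinnertonDyer.BirchSwinnertonDyer.Theses.UniversalToricDescent
  Summit.BirchSwinnertonDyer.BirchSwinnertonDyer.Theorems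
  Summit.BirchSwinnertonDyer.BirchSwinnertonDyer.Theorems.SchneiderFree
  Summit.BirchSwinnertonDyer.BirchSwinnertonDyer.Theorems.SchneiderFreeControlAtoms
  Summit.BirchSwinnertonDyer.BirchSwinnertonDyer.Theorems.SchneiderFreeAdditiveX3
  Summit.BirchSwinnertonDyer.BirchSwinnertonDyer.Theorems.UniversalToricDescentWaldspurgerFlat
  Summit.BirchSwinnertonDyer.BirchSwinnertonDyer.Theorems.AdditivePotSupersingularControl
  Summit.BirchSwinnertonDyer.BirchSwinnertonDyer.Theorems.RamifiedSevenEllipticUnits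
  Summit.BirchSwinnertonDyer.BirchSwinnertonDyer.Theorems.PrintCFram
  GreenbergVatsal2000 GreenbergSelmer

/-! ## §1 The five stubs -/

/-- **Stub 0 `stub_prints` (PRINT — VERBATIM the lead's v7 `stub_prints`: seven refereed named facts; closes by citation).**
[cite: Hsieh2014, Thm. A p. 712 (Doc. Math. 19)] [cite: LiuZhangZhang2018, Thm 1.5.1 and Thm 1.5.3 (Duke Math. J. 167 pp. 748–749)]
[cite: JetchevSkinnerWan2017, Thm. 3.3.1 (arXiv:1512.06894 p. 11)] [cite: MilneADT2006, Ch. I, Thm. 4.10 and Thm. 2.8]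
[cite: BurungaleFlach2024, Thm. 1.1 and Cor. 2] [cite: Cassels1965ArithmeticVIII] -/
theorem stub_prints :
    Hsieh2014.thmA_exists_isHsiehLFunction_unrPeriod_anyLevel ∧
    LiuZhangZhang2018.thm151_thm153_modularCurve_heegnerVector_additive ∧
    ToricPublishedInputs ∧
    (∀ (K : Type) [Field K] [NumberField K], poitouTate_sha_tateDual K) ∧
    bsdTriple_of_hasCM_of_L_one_ne_zero ∧
    hasEntireLFunction_rat ∧
    bsdRHS_eq_of_isIsogenous := by
  sorry

/-- **Stub KL `stub_krizLi` (PRINT — VERBATIM the lead's: Kriz–Li 2019 Thm. 1.20, one refereed named fact; closes by citation).**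
[cite: KrizLi2019, Thm. 1.20 (pp. 7–8) = Thm. 7.1 (pp. 42–43), Rem. 1.17 (p. 6), Rem. 1.21 (p. 8)] -/
theorem stub_krizLi : KrizLi2019.thm120_padicLogHeegner_unit_of_bernoulli := by
  sorry

/-- **Stub H `stub_bottomResidualSelmer_trivial_of_bernoulliPair` [NEW, RESEARCH-M — the LOAD-BEARING stub of this line; Stickelberger–
Herbrand + Leopoldt reflection + Iwasawa–Gillard semi-local unit index (all PRINT, F1–F4 of the header) + ONE class-field-theory identification
(M1)].** For `W/ℚ` globally minimal with CM, `p ≥ 5` CM-ramified; a Heegner field `K''` of `N_W` (so `p ∣ N_W` splits in `K''`); Kriz–Li's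
character data at `p` — `ψ` primitive of conductor `f`, `ω` Teichmüller, `W[p]^{ss} ≅ 𝔽_p(ψ) ⊕ 𝔽_p(ψ⁻¹ω)` in trace form, `ε_{K''}` — and
Kriz–Li's hypothesis (4) `B_{1,ψ₀⁻¹ε_K}·B_{1,ψ₀ω⁻¹} ≢ 0 (mod p)`: for EVERY `ℤ_p`-extension `κ` of `K''` (only its layer `0`, i.e. `K''`
itself, enters), EVERY prime `𝔭 ∋ p` of `K''` and EVERY `Γ_{K''}`-stable line `Φ ≤ W_{K''}[p]` of order `p`, the BOTTOM-LAYER residual Selmer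
groups `R_𝔭^S(K'', Φ)` and `R_𝔭^S(K'', W_{K''}[p]/Φ)` (the tree's `datumStrictSelmer (κ.layerSubgroup 0) … (AcSelmer.bdpData … 𝔭) S`,
`S` = bad primes of `W/K''` off `p`) are TRIVIAL. Rank-free (no `r_an` hypothesis): with print it re-proves `r_an(W/K'') = 1` on the locus,
consistently with Kriz–Li. Why it might fail: (a) the descent of Iwasawa–Gillard to level `0` needs the image of `C_∞` inside `C̄_{K₀}` and
`χ|_{D_p} ≠ 1` exactly as claimed (a unit-index slip by a factor `p` at level `0` would cost the line precisely at the pairs where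
`L_p(χ,1)` is a unit but `[Ē:C̄]` is not — none expected since `p ∤ [ℚ(χ):ℚ]·h⁺`-type indices do not enter `χ`-parts for `p ∤ |G|`);
(b) typing cost: eigenspaces of `Cl_L ⊗ ℤ_p` and of semi-local units under `Gal(L/ℚ)` are not yet Literature notions (F1–F4 become
named facts of a new `Literature/NumberTheory/CyclotomicFields/` section). Sources: header. -/
theorem stub_bottomResidualSelmer_trivial_of_bernoulliPair :
    ∀ (W : WeierstrassCurve ℚ) [W.IsElliptic] [W.IsGloballyMinimal] (p : ℕ) [Fact p.Prime],
      W.HasCM → CMRamified W p → 5 ≤ p →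
      ∀ (N : ℕ) [NeZero N] (K : Type) [Field K] [NumberField K]
        (f : ℕ) [NeZero f] (ψ : DirichletCharacter ℚ_[p] f) (ω : DirichletCharacter ℚ_[p] p)
        (εK : DirichletCharacter ℚ_[p] (NumberField.discr K).natAbs),
        W.conductorNorm ℤ = N → IsImaginaryQuadratic K → SatisfiesHeegnerHypothesis N K →
        ψ.IsPrimitive → KrizLi2019.IsTeichmullerCharacter ω →
        (∀ ℓ : ℕ, ℓ.Prime → ¬ (ℓ ∣ p * W.conductorNorm ℤ) →
          ‖((W.LFunction ℓ : ℤ) : ℚ_[p]) - (ψ (ℓ : ZMod f) + ψ⁻¹ (ℓ : ZMod f) * ω (ℓ : ZMod p))‖ < 1) →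
        KrizLi2019.IsKroneckerCharacterOf K εK →
        ¬ (‖KrizLi2019.bernoulliOnePrim (KrizLi2019.bernoulliCharOne ψ εK) *
            KrizLi2019.bernoulliOnePrim (KrizLi2019.bernoulliCharTwo ψ εK ω)‖ ≤ (p : ℝ)⁻¹) →
      ∀ (κ : ZpExtension K p) (𝔭 : HeightOneSpectrum (𝓞 K)), ((p : ℕ) : 𝓞 K) ∈ 𝔭.asIdeal →
      ∀ (Φ : X2.ResidualDevissageModules.StableSubgroup (absoluteGaloisGroup K) ((W.baseChange K).geomTorsion (p : ℤ))),
        Nat.card Φ.Sub = p →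
        datumStrictSelmer (κ.layerSubgroup 0) Φ.Sub p (AcSelmer.bdpData Φ.Sub p 𝔭)
            {v : HeightOneSpectrum (𝓞 K) | ¬ (W.baseChange K).HasGoodReductionAt v ∧ ((p : ℕ) : 𝓞 K) ∉ v.asIdeal} = ⊥ ∧
        datumStrictSelmer (κ.layerSubgroup 0) Φ.Quot p (AcSelmer.bdpData Φ.Quot p 𝔭)
            {v : HeightOneSpectrum (𝓞 K) | ¬ (W.baseChange K).HasGoodReductionAt v ∧ ((p : ℕ) : 𝓞 K) ∉ v.asIdeal} = ⊥ := by
  sorry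

/-- **Stub Ko⁻ `stub_kolyvaginUpper_offKrizLi` [RESEARCH-M/L — the lead's v7 `stub_kolyvaginUpper_borelCM` (adopted from this seat's
`borel_heegner_squeeze` S2) with ONE extra hypothesis: `¬ ∃ (Kriz–Li datum)` — Kolyvagin's UPPER inequality at the Borel CM-ramified prime is
needed only OFF the Kriz–Li locus in this line; the lead's unrestricted stub implies it.]** Statement, instrument and risks: the lead's
docstring, unchanged. [cite: GrigorovJorzaPatrikisSteinTarnita2009, Thm. 3.7 and Props. 5.2–5.4 (Math. Comp. 78, pp. 2406, 2415)]
[cite: Miller2011LMS, Thm. 5.3 (arXiv:1010.2431 p. 11)] [cite: Jetchev2008, Thm. 1.4] [cite: Gross1991, §§3–5] -/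
theorem stub_kolyvaginUpper_offKrizLi :
    ∀ (W : WeierstrassCurve ℚ) [W.IsElliptic] [W.IsGloballyMinimal] (p : ℕ) [Fact p.Prime],
      W.HasCM → CMRamified W p → 5 ≤ p → W.analyticRank = 1 →
      (¬ ∃ (N : ℕ) (_ : NeZero N) (K : Type) (_ : Field K) (_ : NumberField K) (Dt : ModularParametrizationData W N)
          (H : HeegnerDatum N (NumberField.discr K)) (ι : K →+* ℂ) (P : (W.baseChange K).toAffine.Point)
          (f : ℕ) (_ : NeZero f) (ψ : DirichletCharacter ℚ_[p] f) (ω : DirichletCharacter ℚ_[p] p)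
          (εK : DirichletCharacter ℚ_[p] (NumberField.discr K).natAbs),
          W.conductorNorm ℤ = N ∧ IsImaginaryQuadratic K ∧ SatisfiesHeegnerHypothesis N K ∧ Odd (NumberField.discr K) ∧
          NumberField.discr K < -4 ∧ (W.quadraticTwist (NumberField.discr K : ℚ)).entireLFunction 1 ≠ 0 ∧
          WeierstrassCurve.Affine.Point.map ι.toRatAlgHom P = heegnerPointComplex Dt H ∧
          ψ.IsPrimitive ∧ KrizLi2019.IsTeichmullerCharacter ω ∧
          (∀ ℓ : ℕ, ℓ.Prime → ¬ (ℓ ∣ p * W.conductorNorm ℤ) →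
            ‖((W.LFunction ℓ : ℤ) : ℚ_[p]) - (ψ (ℓ : ZMod f) + ψ⁻¹ (ℓ : ZMod f) * ω (ℓ : ZMod p))‖ < 1) ∧
          ψ (p : ZMod f) ≠ 1 ∧ KrizLi2019.primVal (KrizLi2019.invMulOmega ψ ω) p ≠ 1 ∧
          (∀ ℓ : ℕ, (hℓ : ℓ.Prime) → ℓ ≠ p →
            (haveI := Fact.mk hℓ; ¬ W.HasGoodReductionAtPrime ℓ ∧ ¬ W.HasMultiplicativeReductionAtPrime ℓ) →
            ψ (ℓ : ZMod f) ≠ 1 ∧ KrizLi2019.primVal (KrizLi2019.invMulOmega ψ ω) ℓ ≠ 1) ∧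
          KrizLi2019.IsKroneckerCharacterOf K εK ∧
          ¬ (‖KrizLi2019.bernoulliOnePrim (KrizLi2019.bernoulliCharOne ψ εK) *
              KrizLi2019.bernoulliOnePrim (KrizLi2019.bernoulliCharTwo ψ εK ω)‖ ≤ (p : ℝ)⁻¹)) →
      ∀ (N : ℕ) [NeZero N] (K : Type) [Field K] [NumberField K]
        (Dt : ModularParametrizationData W N) (H : HeegnerDatum N (NumberField.discr K)) (ι : K →+* ℂ)
        (P : (W.baseChange K).toAffine.Point),
        W.conductorNorm ℤ = N → IsImaginaryQuadratic K → Odd (NumberField.discr K) →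
        ¬ p ∣ Units.torsionOrder K → SatisfiesHeegnerHypothesis N K →
        (W.quadraticTwist (NumberField.discr K : ℚ)).entireLFunction 1 ≠ 0 →
        WeierstrassCurve.Affine.Point.map ι.toRatAlgHom P = heegnerPointComplex Dt H →
        ¬ IsOfFinAddOrder P →
        SchneiderFree.Upper.IndexUpperBoundLeAt W p K P (padicValNat p Dt.c.natAbs) := by
  sorry

/-- **Stub 1 `stub_flatEisensteinIncl_cmRamified_offKrizLi` [RESEARCH — VERBATIM the lead's v7 β1 off the Kriz–Li locus].** Statement,
mechanism and risks: the lead's docstring, unchanged. [cite: JetchevSkinnerWan2017, §7.4.1 (arXiv:1512.06894 p. 30)]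
[cite: Hsieh2014, Thm. A p. 712 (Doc. Math. 19)] -/
theorem stub_flatEisensteinIncl_cmRamified_offKrizLi :
    ∀ (p : ℕ) [Fact p.Prime] (W : WeierstrassCurve ℚ) [W.IsElliptic] [W.IsGloballyMinimal],
      W.HasCM → CMRamified W p → 5 ≤ p → W.analyticRank = 1 →
      (¬ ∃ (N : ℕ) (_ : NeZero N) (K : Type) (_ : Field K) (_ : NumberField K) (Dt : ModularParametrizationData W N)
          (H : HeegnerDatum N (NumberField.discr K)) (ι : K →+* ℂ) (P : (W.baseChange K).toAffine.Point)
          (f : ℕ) (_ : NeZero f) (ψ : DirichletCharacter ℚ_[p] f) (ω : DirichletCharacter ℚ_[p] p)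
          (εK : DirichletCharacter ℚ_[p] (NumberField.discr K).natAbs),
          W.conductorNorm ℤ = N ∧ IsImaginaryQuadratic K ∧ SatisfiesHeegnerHypothesis N K ∧ Odd (NumberField.discr K) ∧
          NumberField.discr K < -4 ∧ (W.quadraticTwist (NumberField.discr K : ℚ)).entireLFunction 1 ≠ 0 ∧
          WeierstrassCurve.Affine.Point.map ι.toRatAlgHom P = heegnerPointComplex Dt H ∧
          ψ.IsPrimitive ∧ KrizLi2019.IsTeichmullerCharacter ω ∧
          (∀ ℓ : ℕ, ℓ.Prime → ¬ (ℓ ∣ p * W.conductorNorm ℤ) →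
            ‖((W.LFunction ℓ : ℤ) : ℚ_[p]) - (ψ (ℓ : ZMod f) + ψ⁻¹ (ℓ : ZMod f) * ω (ℓ : ZMod p))‖ < 1) ∧
          ψ (p : ZMod f) ≠ 1 ∧ KrizLi2019.primVal (KrizLi2019.invMulOmega ψ ω) p ≠ 1 ∧
          (∀ ℓ : ℕ, (hℓ : ℓ.Prime) → ℓ ≠ p →
            (haveI := Fact.mk hℓ; ¬ W.HasGoodReductionAtPrime ℓ ∧ ¬ W.HasMultiplicativeReductionAtPrime ℓ) →
            ψ (ℓ : ZMod f) ≠ 1 ∧ KrizLi2019.primVal (KrizLi2019.invMulOmega ψ ω) ℓ ≠ 1) ∧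
          KrizLi2019.IsKroneckerCharacterOf K εK ∧
          ¬ (‖KrizLi2019.bernoulliOnePrim (KrizLi2019.bernoulliCharOne ψ εK) *
              KrizLi2019.bernoulliOnePrim (KrizLi2019.bernoulliCharTwo ψ εK ω)‖ ≤ (p : ℝ)⁻¹)) →
      ∀ (N : ℕ) [NeZero N] (K : Type) [Field K] [NumberField K] (Dt : ModularParametrizationData W N),
      W.conductorNorm ℤ = N → IsImaginaryQuadratic K → SatisfiesHeegnerHypothesis N K →
      ∀ (κ : ZpExtension K p), κ.IsAnticyclotomic → ∀ (γ : Field.absoluteGaloisGroup K) [Fact (κ.IsTopGenerator γ)]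
        (𝔭 : HeightOneSpectrum (𝓞 K)), ((p : ℕ) : 𝓞 K) ∈ 𝔭.asIdeal → 𝔭.asIdeal.ramificationIdx (𝓞 ℚ) = 1 →
        𝔭.asIdeal.inertiaDeg (𝓞 ℚ) = 1 → ∀ (𝔭' : HeightOneSpectrum (𝓞 K)), ((p : ℕ) : 𝓞 K) ∈ 𝔭'.asIdeal → 𝔭' ≠ 𝔭 →
        ∀ (ι' : PadicAlgCl p ≃+* ℂ), SchneiderFree.BranchInducesPrime p ι' 𝔭 →
        ∀ (ΩK : ℂ) (Ωp : ℂ_[p]) (Q : PowerSeries (PadicComplexInt p)), ΩK ≠ 0 → Ωp ≠ 0 →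
          R1.IsBDPLFunctionInt p ι' 𝔭 κ γ Dt.f ΩK Ωp Q →
          Module.IsTorsion (IwasawaAlgebra p) (XAc (W.baseChange K) p κ 𝔭' ∅ γ) →
          (XAc.charIdeal (W.baseChange K) p κ 𝔭' ∅ γ).map (PowerSeries.map (R1.toCpInt p)) ≤ Ideal.span {Q} := by
  sorry

/-! ## §2 The kernel-checked composition: Kriz–Li datum (PRINT + Stub H) ∨ none (β1 + Kolyvagin off the locus) -/

/-- **COMPOSITION `BottomClassIndexLawFiveLe_of` (stub-fed, pointwise in the curve), TWO cases.** (KL) a Kriz–Li datum `(K'', P, ψ, …)`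
exists ⟹ choose ANY anticyclotomic `ℤ_p`-extension `κ` of `K''` (`ZpExtension.exists_isAnticyclotomic_holds`, a theorem of the
tree), a topological generator `γ`, a prime `𝔭 ∋ p` (degree one by the Heegner hypothesis, `p ∣ N_W`); take the kernel `Φ` of the
certified rational `p`-isogeny base-changed to `K''` with both no-fixed-vector clauses (`IsogenyLineData.exists_line_noFixed_of_isogeny`,
from `W(ℚ_p)[p] = 0 = W₁(ℚ_p)[p]`); Stub H empties both bottom-layer residual Selmer groups; `natCard_residualSelmer_eq_one_of_bottom`
(w2g4, Nakayama over `𝔽_p⟦Γ⟧`) makes the frame REGULAR; the lead's PRINT-ONLY regular-locus theorem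
`RegularLocus.ramifiedCMBottomClassIndexLawAtZp_of_regularKrizLiDatum` (p630429) fed with `stub_prints`, `stub_krizLi` concludes.
(¬KL) no datum ⟹ the lead's case (C) verbatim: `KrizLiKolyvagin.ramifiedCMBottomClassIndexLawAtZp_of_flatIncl_of_indexUpper` from
`stub_prints`, β1 (its `¬ ∃` hypothesis is the case hypothesis) and `stub_kolyvaginUpper_offKrizLi` (ditto). No `sorry` in this proof;
CONDITIONAL on the stubs; the GZK antecedent of the crux is not used. BSD is not proved by any of this.
[cite: KrizLi2019, Thm. 1.20 (pp. 7–8) and p. 3] [cite: Gross1980LNM776, §22.3 Lemma 22.3.4, Cor. 22.3.5, Thm. 22.3.6 (PDF pp. 80–82) — nearest prior art] [cite: GreenbergLNM1716, §3 Lemmas 3.1–3.2 (PDF p. 86)] -/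
theorem BottomClassIndexLawFiveLe_of :
    Summit.BirchSwinnertonDyer.BirchSwinnertonDyer.Theses.PrintCFram.BottomClassIndexLawFiveLe := by
  intro _hGZK W _ _ p _ hCM hram h5 hr
  have hp : p.Prime := Fact.out
  have hp2 : p ≠ 2 := by omega
  by_cases hKLd : ∃ (N : ℕ) (_ : NeZero N) (K : Type) (_ : Field K) (_ : NumberField K) (Dt : ModularParametrizationData W N)
          (H : HeegnerDatum N (NumberField.discr K)) (ι : K →+* ℂ) (P : (W.baseChange K).toAffine.Point)
          (f : ℕ) (_ : NeZero f) (ψ : DirichletCharacter ℚ_[p] f) (ω : DirichletCharacter ℚ_[p] p)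
          (εK : DirichletCharacter ℚ_[p] (NumberField.discr K).natAbs),
          W.conductorNorm ℤ = N ∧ IsImaginaryQuadratic K ∧ SatisfiesHeegnerHypothesis N K ∧ Odd (NumberField.discr K) ∧
          NumberField.discr K < -4 ∧ (W.quadraticTwist (NumberField.discr K : ℚ)).entireLFunction 1 ≠ 0 ∧
          WeierstrassCurve.Affine.Point.map ι.toRatAlgHom P = heegnerPointComplex Dt H ∧
          ψ.IsPrimitive ∧ KrizLi2019.IsTeichmullerCharacter ω ∧
          (∀ ℓ : ℕ, ℓ.Prime → ¬ (ℓ ∣ p * W.conductorNorm ℤ) →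
            ‖((W.LFunction ℓ : ℤ) : ℚ_[p]) - (ψ (ℓ : ZMod f) + ψ⁻¹ (ℓ : ZMod f) * ω (ℓ : ZMod p))‖ < 1) ∧
          ψ (p : ZMod f) ≠ 1 ∧ KrizLi2019.primVal (KrizLi2019.invMulOmega ψ ω) p ≠ 1 ∧
          (∀ ℓ : ℕ, (hℓ : ℓ.Prime) → ℓ ≠ p →
            (haveI := Fact.mk hℓ; ¬ W.HasGoodReductionAtPrime ℓ ∧ ¬ W.HasMultiplicativeReductionAtPrime ℓ) →
            ψ (ℓ : ZMod f) ≠ 1 ∧ KrizLi2019.primVal (KrizLi2019.invMulOmega ψ ω) ℓ ≠ 1) ∧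
          KrizLi2019.IsKroneckerCharacterOf K εK ∧
          ¬ (‖KrizLi2019.bernoulliOnePrim (KrizLi2019.bernoulliCharOne ψ εK) *
              KrizLi2019.bernoulliOnePrim (KrizLi2019.bernoulliCharTwo ψ εK ω)‖ ≤ (p : ℝ)⁻¹)
  · -- (KL) a Kriz–Li datum: regularity from Stub H at the bottom layer, then the lead's PRINT-ONLY regular-locus theorem
    obtain ⟨N, _, K, _, _, Dt, H, ι, P, f, _, ψ, ω, εK, hN, hK, hHN, hodd, hd4, hLt, hP, hψ, hω, hss, h1, h1', h3, hεK, h4⟩ :=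
      hKLd
    haveI hEK : (W.baseChange K).IsElliptic := inferInstanceAs (W.map (algebraMap ℚ K)).IsElliptic
    -- a frame: an anticyclotomic `ℤ_p`-extension of `K''`, a topological generator, a (degree-one) prime above `p`
    have himag : ∀ w : InfinitePlace K, w.IsComplex := fun w ↦ hK.2.isComplex w
    obtain ⟨κ, hκ⟩ := ZpExtension.exists_isAnticyclotomic_holds (K := K) (p := p) hK.1 himag
    obtain ⟨γ, hγ⟩ := κ.exists_isTopGenerator
    haveI hγF : Fact (κ.IsTopGenerator γ) := ⟨hγ⟩
    obtain ⟨𝔭, h𝔭⟩ := RingOfIntegers.exists_heightOneSpectrum_natCast_mem K hp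
    have hadd : Addv W p := EisensteinResourceBdpLine.addv_of_cmRamified W hCM hram h5
    have hpN : p ∣ N := by
      rw [← hN]; exact (W.dvd_conductorNorm_iff_not_hasGoodReductionAtPrime p).mpr hadd.1
    obtain ⟨he, hf⟩ := UniversalToricDescentStrictPlace.degreeOne_of_dvd_of_heegner hK hHN hpN h𝔭
    -- the line: kernel of the certified rational `p`-isogeny over `K''`, with both no-fixed-vector clauses
    obtain ⟨W₁, _, _, -, -, hW₁, g, hg⟩ :=
      RationalPIsogeny.exists_rational_pIsogeny_noPTorsionPadic_of_cmRamified W p hCM h5 hram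
    have hW := RamifiedSevenEllipticUnits.prime_nsmul_eq_zero_padic_of_hasCM_of_cmRamified W p hCM h5 hram
    obtain ⟨Φ, hSub, -, hfixS, hfixQ⟩ :=
      IsogenyLineData.exists_line_noFixed_of_isogeny W W₁ p g K hg hW hW₁ κ h𝔭 he hf
    -- bottom layer from the Bernoulli pair (Stub H); tower cardinalities from the bottom layer (landed, w2g4)
    obtain ⟨hS0, hQ0⟩ := stub_bottomResidualSelmer_trivial_of_bernoulliPair W p hCM hram h5 N K f ψ ω εK hN hK hHN hψ hω hss
      hεK h4 κ 𝔭 h𝔭 Φ hSub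
    obtain ⟨hc1, hc2⟩ :=
      RegularLocusBottomLayer.natCard_residualSelmer_eq_one_of_bottom (W.baseChange K) κ hγ 𝔭 _ Φ hfixS hfixQ hS0 hQ0
    exact RegularLocus.ramifiedCMBottomClassIndexLawAtZp_of_regularKrizLiDatum stub_prints stub_krizLi W hCM hram h5 hr N K Dt H ι P
      hN hK hHN hodd hd4 hLt hP f ψ ω hψ hω hss h1 h1' h3 εK hεK h4 κ hκ γ 𝔭 h𝔭
      ⟨Φ, fun y hy ↦ hfixQ y fun σ hσ ↦ hy ⟨σ, hσ⟩, hc1, hc2⟩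
  · -- (¬KL) no Kriz–Li datum: the lead's case (C) — β1 and Kolyvagin, both restricted off the locus by the case hypothesis
    exact KrizLiKolyvagin.ramifiedCMBottomClassIndexLawAtZp_of_flatIncl_of_indexUpper stub_prints W hCM hram h5 hr
      (stub_flatEisensteinIncl_cmRamified_offKrizLi p W hCM hram h5 hr hKLd)
      (fun N _ K _ _ Dt H ι P hN hK hodd hw hHN hLt hP hnt ↦
        stub_kolyvaginUpper_offKrizLi W p hCM hram h5 hr hKLd N K Dt H ι P hN hK hodd hw hHN hLt hP hnt)

end Summit.BirchSwinnertonDyer.BirchSwinnertonDyer.Cruxes.BottomClassIndexLawFiveLe.HerbrandRegularLocus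

end
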